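import Literature.Computability.AlgebraicComplexity.AlmanLi2026TensorSquareSpeedup
import Literature.Computability.AlgebraicComplexity.AlmanLi2026BelowBorderRank
import Literature.Computability.AlgebraicComplexity.AlmanLi2026AnalysisFacts
import HarnessLib

/-!
# `R̃(T) ≤ sqrt(d^{4ω/3} − ⌊d/3⌋·(2^{ω/3}−1)·d^{2ω/3})` for every `d×d×d` tensor (Alman–Li 2026, Thm. 7.2 = Thm. 1.4)

Topic `Literature/Computability/AlgebraicComplexity` (family `MatrixMultiplication`). Source: J. Alman,
B. Li, *Asymptotic Rank Speedup Theorems, Revisited*, arXiv:2605.21738 (2026), §7.2, Theorem 7.2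
(= Thm. 1.4 of the introduction) with its printed proof (held text `paper:arxiv-2605.21738`,
p. 19 L13–58), read first-hand; the degeneration step is Lemma 7.2 (`AlmanLi2026.lemma72`,
`AlmanLi2026TensorSquareSpeedup.lean`), the analysis steps are Lemmas 9.3 / 9.4
(`AlmanLi2026.lemma93` / `lemma94`, `AlmanLi2026AnalysisFacts.lean`).

## The printed statement and proof (p. 19 L13–58)

"Theorem 7.2. When `d ≥ 3`, any `d×d×d` tensor `T` satisfies
`R̃(T) ≤ sqrt(d^{4ω/3} − ⌊d/3⌋ · (2^{ω/3} − 1) d^{2ω/3})`.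
Proof. Apply the previous lemma with `p = ⌊d/3⌋` and `d_α = 3` for all `α`. It gives the degeneration
`T^{⊗2} ⊕ p ⊙ ⟨1,2d²,1⟩ ⊴ ⟨d,d²,d⟩ ⊕ p ⊙ ⟨1,d²,1⟩`. Fix an arbitrary spectral point `φ ∈ 𝒳`, and let
`(θ₁,θ₂,θ₃) ∈ Θ_MM` be its parameters. Passing to the asymptotic spectrum yields
`φ(T)² ≤ d^{θ₁+2θ₂+θ₃} − (2^{θ₂}−1) p d^{2θ₂}`. By permuting tensor modes, we obtain the analogous
bounds for `i ∈ {1,2,3}`: `φ(T)² ≤ d^{ϖ+θᵢ} − (2^{θᵢ}−1) p d^{2θᵢ}`, where `ϖ ≔ θ₁+θ₂+θ₃`. Let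
`θ ≔ min{θ₁,θ₂,θ₃}`, so `θ ≤ ϖ/3`. Define `h_ϖ(x) ≔ d^{ϖ+x} − (2^x−1) p d^{2x}`. Then `φ(T)² ≤ h_ϖ(θ)`.
By (Lemma 9.3), `h_ϖ` is increasing on `[0,ϖ/3]`, hence `φ(T)² ≤ h_ϖ(ϖ/3) = d^{4ϖ/3} − (2^{ϖ/3}−1) p d^{2ϖ/3}`.
By (Lemma 9.4), the right-hand side is increasing in `ϖ` on `[2,ω]`; since `ϖ ≤ ω` … we obtain
`φ(T)² ≤ d^{4ω/3} − (2^{ω/3}−1) p d^{2ω/3}`. Finally, taking the maximum over `φ ∈ 𝒳` and using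
Strassen duality yields [the claim]."

## The form proved here

* `AlmanLi2026.lemma72_lines` — Lemma 7.2 relabelled into the tree's vocabulary with UNIFORM target
  slices: `⟨d,d²,d⟩ ⊕ ⟨p⟩ ⊠ ⟨d²,1,1⟩ ⊵ T^{⊗2} ⊕ ⟨p⟩ ⊠ ⟨t,1,1⟩` whenever every part of the block map
  `α : Fin d → Fin p` has `≥ t/d² + 1` elements (`⟨s,1,1⟩ = matMulTensor K s 1 1 ≅ ⟨1,s,1⟩` with its
  trivial modes placed as in `AlmanLi2026IteratedSpectrumBound.lean`; `p ⊙ X = ⟨p⟩ ⊠ X`;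
  `⟨d,d²,d⟩ = rotate (matMulTensor K d (d·d) d)`).
* `AlmanLi2026.thm72_degeneration` — "`p = ⌊d/3⌋`, `d_α = 3`": the block map `i ↦ min(⌊i/3⌋, p−1)`
  (the `d − 3p` left-over rows join the last part, which only helps), `t = 2d²`.
* `AlmanLi2026.thm72_spectral` (the three displays, `i = 0,1,2`), `AlmanLi2026.thm72_pointwise`
  (`φ(T)² ≤ d^{4ω/3} − (2^{ω/3}−1) p d^{2ω/3}`, via Lemmas 9.3, 9.4 and `ϖ ≤ ω ≤ 3`),
  `AlmanLi2026.thm72` (Strassen duality, the tree's `strassen_duality_asymptoticRank_holds`).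
  `ω = omega K` of the field `K`.

## References

* J. Alman, B. Li, arXiv:2605.21738 (2026), Thm. 7.2 (= Thm. 1.4) and its proof (§7.2, p. 19);
  Lemma 7.2; Lemmas 9.3, 9.4; Props. 4.1, 4.2 (spectral points on matrix multiplication tensors).
  [AlmanLi2026]
* M. Bläser, *Fast Matrix Multiplication* (2013), Lemma 5.5 (rotating `⟨k,m,n⟩`). [Blaser2013]
-/

noncomputable section

open scoped BigOperators

namespace Literature.Computability.AlgebraicComplexity

namespace AlmanLi2026

/-! ## Relabellings (private plumbing) -/

section Plumbing

variable {K : Type} [CommSemiring K]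
variable {ι κ μ ι' κ' μ' : Type}

/-- `rotate (s ⊕ t) = rotate s ⊕ rotate t` (plumbing). [folklore] -/
private theorem rotate_directSum₇₂ (s : ι → κ → μ → K) (t : ι' → κ' → μ' → K) :
    rotate (directSumTensor s t) = directSumTensor (rotate s) (rotate t) := by
  funext b c a
  rcases a with a | a <;> rcases b with b | b <;> rcases c with c | c <;> rfl

/-- `rotate (s ⊠ t) = rotate s ⊠ rotate t` (plumbing). [folklore] -/
private theorem rotate_kronecker₇₂ (s : ι → κ → μ → K) (t : ι' → κ' → μ' → K) :
    rotate (kroneckerTensor s t) = kroneckerTensor (rotate s) (rotate t) := rfl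

omit [CommSemiring K] in
/-- `rotate³ = id` (plumbing). [folklore] -/
private theorem rotate_rotate_rotate₇₂ (t : ι → κ → μ → K) : rotate (rotate (rotate t)) = t := rfl

/-- `rotate ⟨n⟩ = ⟨n⟩` (plumbing). [folklore] -/
private theorem rotate_unitTensor₇₂ (n : ℕ) : rotate (unitTensor K n) = unitTensor K n := by
  funext b c a
  simp only [rotate_apply, unitTensor_apply]
  exact if_congr ⟨fun ⟨h1, h2⟩ => ⟨h2, (h1.trans h2).symm⟩, fun ⟨h1, h2⟩ => ⟨(h1.trans h2).symm, h1⟩⟩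
    rfl rfl

/-- `rotate ⟨k,m,n⟩ ≥ ⟨m,n,k⟩` (swap coordinates; converse of the tree's
`tensorRestrictsTo_matMulTensor_rotate'`). [cite: Blaser2013, Lemma 5.5] -/
private theorem tensorRestrictsTo_rotate_matMulTensor₇₂ (k m n : ℕ) :
    TensorRestrictsTo (rotate (matMulTensor K k m n)) (matMulTensor K m n k) := by
  have h : matMulTensor K m n k = fun b c a =>
      rotate (matMulTensor K k m n) (Prod.swap b) c (Prod.swap a) := by
    funext b c a
    rw [rotate_matMulTensor_eq]
    simp
  rw [h]
  exact tensorRestrictsTo_precomp (rotate (matMulTensor K k m n)) Prod.swap id Prod.swap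

/-- `⟨s,1,1⟩ ≅ rotate (oneSlice(Fin s))`: the two restrictions (drop / insert the trivial `Fin 1`
coordinates). [cite: AlmanLi2026, §5.3] -/
private theorem tensorRestrictsTo_rotate_oneSlice_line (s : ℕ) :
    TensorRestrictsTo (rotate (oneSliceTensor K (Fin s))) (matMulTensor K s 1 1) := by
  have h : matMulTensor K s 1 1 = fun (a : Fin s × Fin 1) (b : Fin s × Fin 1) (_ : Fin 1 × Fin 1) =>
      rotate (oneSliceTensor K (Fin s)) a.1 b.1 () := by
    funext a b c
    simp [matMulTensor, rotate_apply, oneSliceTensor_apply, eq_iff_true_of_subsingleton]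
  rw [h]
  exact tensorRestrictsTo_precomp _ _ _ _

/-- `⟨s,1,1⟩ ≥ rotate (oneSlice(Fin s))` (insert the trivial `Fin 1` coordinates). [cite: AlmanLi2026, §5.3] -/
private theorem tensorRestrictsTo_line_rotate_oneSlice (s : ℕ) :
    TensorRestrictsTo (matMulTensor K s 1 1) (rotate (oneSliceTensor K (Fin s))) := by
  have h : rotate (oneSliceTensor K (Fin s)) = fun (x y : Fin s) (_ : Unit) =>
      matMulTensor K s 1 1 (x, 0) (y, 0) ((0 : Fin 1), (0 : Fin 1)) := by
    funext x y u
    simp [matMulTensor, rotate_apply, oneSliceTensor_apply]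
  rw [h]
  exact tensorRestrictsTo_precomp _ _ _ _

end Plumbing

/-! ## Lemma 7.2 with uniform target slices, in the tree's vocabulary -/

/-- **Lemma 7.2, relabelled** (uniform target slices): for `T : Fin d → Fin d → Fin d → K` over a
field, a block map `α : Fin d → Fin p` and `t` with `t ≤ (d_γ − 1)·d²` for every part,
`⟨d,d²,d⟩ ⊕ ⟨p⟩ ⊠ ⟨d²,1,1⟩ ⊵ T^{⊗2} ⊕ ⟨p⟩ ⊠ ⟨t,1,1⟩` (`⟨d,d²,d⟩ = rotate (matMulTensor K d (d·d) d)`,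
slices `⟨s,1,1⟩ = matMulTensor K s 1 1`). [cite: AlmanLi2026, Lemma 7.2] -/
theorem lemma72_lines {K : Type} [Field K] (d p t : ℕ) (T : Fin d → Fin d → Fin d → K)
    (α : Fin d → Fin p) (ht : ∀ γ, t ≤ (Fintype.card {i : Fin d // α i = γ} - 1) * (d * d)) :
    AlgDegeneratesTo
      (directSumTensor (rotate (matMulTensor K d (d * d) d))
        (kroneckerTensor (unitTensor K p) (matMulTensor K (d * d) 1 1)))
      (directSumTensor (kroneckerTensor T T)
        (kroneckerTensor (unitTensor K p) (matMulTensor K t 1 1))) := by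
  classical
  have h := lemma72 (K := K) d T (P := Fin p) α
  -- source: `rotate ⟨d,d·d,d⟩ ≥ [J=J' ∧ w=(i,k)]` and `⟨p⟩ ⊠ ⟨d·d,1,1⟩ ≥ blockSlice Prod.fst`
  have hS₁ : TensorRestrictsTo (rotate (matMulTensor K d (d * d) d))
      (fun (x : Fin d × (Fin d × Fin d)) (y : (Fin d × Fin d) × Fin d) (z : Fin d × Fin d) =>
        if x.2 = y.1 ∧ z = (x.1, y.2) then (1 : K) else 0) := by
    have e : (fun (x : Fin d × (Fin d × Fin d)) (y : (Fin d × Fin d) × Fin d) (z : Fin d × Fin d) =>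
        if x.2 = y.1 ∧ z = (x.1, y.2) then (1 : K) else 0) = fun x y z =>
        rotate (matMulTensor K d (d * d) d) (x.1, finProdFinEquiv x.2) (finProdFinEquiv y.1, y.2) z := by
      funext x y z
      obtain ⟨i, J⟩ := x
      obtain ⟨J', k⟩ := y
      obtain ⟨z₁, z₂⟩ := z
      simp only [rotate_apply, matMulTensor, EmbeddingLike.apply_eq_iff_eq, Prod.mk.injEq]
      by_cases h1 : J = J' <;> by_cases h2 : z₁ = i <;> by_cases h3 : z₂ = k <;> simp [h1, h2, h3]
    rw [e]
    exact tensorRestrictsTo_precomp _ _ _ _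
  have hS₂ : TensorRestrictsTo (kroneckerTensor (unitTensor K p) (matMulTensor K (d * d) 1 1))
      (blockSliceTensor K (Prod.fst : Fin p × (Fin d × Fin d) → Fin p)) :=
    (((TensorRestrictsTo.refl _).kronecker (tensorRestrictsTo_line_rotate_oneSlice (K := K) (d * d))).trans
      (tensorRestrictsTo_kronecker_blockSliceTensor_fst (K := K) (σ := Fin (d * d)) p)).trans
      (tensorRestrictsTo_blockSliceTensor_of_comp_eq (K := K)
        (g := (Prod.fst : Fin p × Fin (d * d) → Fin p))
        (g' := (Prod.fst : Fin p × (Fin d × Fin d) → Fin p))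
        (e := Prod.map id finProdFinEquiv) (f := id)
        (Function.Injective.prodMap Function.injective_id finProdFinEquiv.injective)
        Function.injective_id (fun _ => rfl))
  -- target: shrink every block to `t`, then `blockSlice Prod.fst = ⟨p⟩ ⊠ ⟨1,t,1⟩ ≥ ⟨p⟩ ⊠ ⟨t,1,1⟩`
  have hT : TensorRestrictsTo
      (blockSliceTensor K (Sigma.fst :
        (Σ γ : Fin p, Fin ((Fintype.card {i : Fin d // α i = γ} - 1) * (d * d))) → Fin p))
      (kroneckerTensor (unitTensor K p) (matMulTensor K t 1 1)) := by
    refine (tensorRestrictsTo_blockSliceTensor_of_comp_eq (K := K)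
      (g' := (Prod.fst : Fin p × Fin t → Fin p)) (e := fun x => ⟨x.1, Fin.castLE (ht x.1) x.2⟩)
      (f := id) ?_ Function.injective_id (fun _ => rfl)).trans
      ((tensorRestrictsTo_blockSliceTensor_fst_kronecker (K := K) (σ := Fin t) p).trans
        ((TensorRestrictsTo.refl _).kronecker (tensorRestrictsTo_rotate_oneSlice_line (K := K) t)))
    rintro ⟨γ, k⟩ ⟨β, l⟩ hxy
    obtain ⟨rfl, h2⟩ := Sigma.mk.inj_iff.mp hxy
    have := Fin.castLE_injective _ (eq_of_heq h2)
    subst this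
    rfl
  exact ((hS₁.directSum hS₂).algDegeneratesTo_trans h).trans_restrictsTo
    ((TensorRestrictsTo.refl _).directSum hT)

/-! ## Thm. 7.2: the degeneration with `p = ⌊d/3⌋`, `d_α = 3` -/

/-- **"Apply the previous lemma with `p = ⌊d/3⌋` and `d_α = 3`"**: for `d ≥ 3`,
`⟨d,d²,d⟩ ⊕ ⟨⌊d/3⌋⟩ ⊠ ⟨d²,1,1⟩ ⊵ T^{⊗2} ⊕ ⟨⌊d/3⌋⟩ ⊠ ⟨2d²,1,1⟩` (block map `i ↦ min(⌊i/3⌋, ⌊d/3⌋−1)`,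
every part having at least `3` elements). [cite: AlmanLi2026, Thm. 7.2 (proof, first display)] -/
theorem thm72_degeneration {K : Type} [Field K] {d : ℕ} (hd : 3 ≤ d)
    (T : Fin d → Fin d → Fin d → K) :
    AlgDegeneratesTo
      (directSumTensor (rotate (matMulTensor K d (d * d) d))
        (kroneckerTensor (unitTensor K (d / 3)) (matMulTensor K (d * d) 1 1)))
      (directSumTensor (kroneckerTensor T T)
        (kroneckerTensor (unitTensor K (d / 3)) (matMulTensor K (2 * (d * d)) 1 1))) := by
  have hp : 1 ≤ d / 3 := (Nat.le_div_iff_mul_le (by norm_num)).2 (by omega)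
  -- the block map and its parts of size ≥ 3
  let α : Fin d → Fin (d / 3) := fun i => ⟨min (i.val / 3) (d / 3 - 1), by omega⟩
  refine lemma72_lines d (d / 3) (2 * (d * d)) T α fun γ => ?_
  have h3 : 3 ≤ Fintype.card {i : Fin d // α i = γ} := by
    have hγ := γ.isLt
    have hγd : 3 * γ.val + 2 < d := by
      have := Nat.div_mul_le_self d 3
      omega
    let e : Fin 3 → {i : Fin d // α i = γ} := fun k =>
      ⟨⟨3 * γ.val + k.val, by omega⟩, by
        apply Fin.ext
        show min ((3 * γ.val + k.val) / 3) (d / 3 - 1) = γ.val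
        have hk := k.isLt
        have e1 : (3 * γ.val + k.val) / 3 = γ.val := by omega
        rw [e1]
        exact min_eq_left (by omega)⟩
    have he : Function.Injective e := by
      intro k k' hkk'
      have := congrArg (fun x : {i : Fin d // α i = γ} => x.1.val) hkk'
      exact Fin.ext (by simpa [e] using this)
    simpa using Fintype.card_le_of_injective e he
  calc 2 * (d * d) = (3 - 1) * (d * d) := by ring
    _ ≤ (Fintype.card {i : Fin d // α i = γ} - 1) * (d * d) :=
        Nat.mul_le_mul_right _ (by omega)

/-! ## The three spectral inequalities -/

section Spectral

variable {K : Type} [Field K] {F : SpectralMap K} (hF : IsUniversalSpectralPoint K F)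
include hF

/-- `φ(rotate ⟨k,m,n⟩) = φ(⟨m,n,k⟩)`. [cite: Blaser2013, Lemma 5.5] -/
private theorem map_rotate_matMul₇₂ (k m n : ℕ) :
    F (rotate (matMulTensor K k m n)) = F (matMulTensor K m n k) :=
  le_antisymm (hF.mono _ _ (tensorRestrictsTo_matMulTensor_rotate' k m n))
    (hF.mono _ _ (tensorRestrictsTo_rotate_matMulTensor₇₂ k m n))

/-- `φ(rotate² ⟨k,m,n⟩) = φ(⟨n,k,m⟩)`. [cite: Blaser2013, Lemma 5.5] -/
private theorem map_rotate_rotate_matMul₇₂ (k m n : ℕ) :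
    F (rotate (rotate (matMulTensor K k m n))) = F (matMulTensor K n k m) := by
  have h₁ : F (rotate (rotate (matMulTensor K k m n))) = F (rotate (matMulTensor K m n k)) :=
    le_antisymm
      (hF.mono _ _ (tensorRestrictsTo_rotate_modes (tensorRestrictsTo_matMulTensor_rotate' k m n)))
      (hF.mono _ _ (tensorRestrictsTo_rotate_modes (tensorRestrictsTo_rotate_matMulTensor₇₂ k m n)))
  rw [h₁, map_rotate_matMul₇₂ hF]

/-- **"Passing to the asymptotic spectrum … by permuting tensor modes"** (Thm. 7.2, proof): for every
universal spectral point with exponents `θ`, every `T : Fin d → Fin d → Fin d → K` (`d ≥ 3`) and each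
direction `i`, `φ(T)² + ⌊d/3⌋ (2d²)^{θᵢ} ≤ d^{(θ₀+θ₁+θ₂)+θᵢ} + ⌊d/3⌋ (d²)^{θᵢ}`, i.e.
`φ(T)² ≤ d^{ϖ+θᵢ} − (2^{θᵢ}−1) p d^{2θᵢ}`. [cite: AlmanLi2026, Thm. 7.2 (proof: the displays with ϖ)] -/
theorem thm72_spectral {d : ℕ} (hd : 3 ≤ d) (T : Fin d → Fin d → Fin d → K) (i : Fin 3) :
    F T ^ 2 + ((d / 3 : ℕ) : ℝ) * ((2 * (d * d) : ℕ) : ℝ) ^ specMMPoint K F i ≤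
      (d : ℝ) ^ ((∑ j, specMMPoint K F j) + specMMPoint K F i) +
        ((d / 3 : ℕ) : ℝ) * ((d * d : ℕ) : ℝ) ^ specMMPoint K F i := by
  have hd1 : 1 ≤ d := by omega
  have hd0 : (0 : ℝ) < d := by exact_mod_cast (show 0 < d by omega)
  have hdd : 1 ≤ d * d := Nat.one_le_iff_ne_zero.2 (by positivity)
  have h2dd : 1 ≤ 2 * (d * d) := by omega
  have cs : ((d * d : ℕ) : ℝ) = (d : ℝ) * d := by push_cast; ring
  -- `φ(⟨d·d,d,d⟩) = (d·d)^{θ₀} d^{θ₁} d^{θ₂}` and its rotations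
  have hS₀ : F (matMulTensor K (d * d) d d) =
      ((d : ℝ) * d) ^ specMMPoint K F 0 * (d : ℝ) ^ specMMPoint K F 1 * (d : ℝ) ^ specMMPoint K F 2 := by
    rw [AlmanLi2026.prop41 hF hdd hd1 hd1, cs]
  have hS₁ : F (matMulTensor K d (d * d) d) =
      (d : ℝ) ^ specMMPoint K F 0 * ((d : ℝ) * d) ^ specMMPoint K F 1 * (d : ℝ) ^ specMMPoint K F 2 := by
    rw [AlmanLi2026.prop41 hF hd1 hdd hd1, cs]
  have hS₂ : F (matMulTensor K d d (d * d)) =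
      (d : ℝ) ^ specMMPoint K F 0 * (d : ℝ) ^ specMMPoint K F 1 * ((d : ℝ) * d) ^ specMMPoint K F 2 := by
    rw [AlmanLi2026.prop41 hF hd1 hd1 hdd, cs]
  have hmul : ∀ x : ℝ, ((d : ℝ) * d) ^ x = (d : ℝ) ^ x * (d : ℝ) ^ x := fun x =>
    Real.mul_rpow hd0.le hd0.le
  have hsum : (d : ℝ) ^ ((∑ j, specMMPoint K F j) + specMMPoint K F i) =
      (d : ℝ) ^ specMMPoint K F 0 * (d : ℝ) ^ specMMPoint K F 1 * (d : ℝ) ^ specMMPoint K F 2 *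
        (d : ℝ) ^ specMMPoint K F i := by
    rw [Fin.sum_univ_three, Real.rpow_add hd0, Real.rpow_add hd0, Real.rpow_add hd0]
  rw [hsum, cs]
  fin_cases i
  · -- direction `θ₀`: the degeneration as produced
    have h := hF.mono_of_algDegeneratesTo (thm72_degeneration hd T)
    rw [hF.map_directSum, hF.map_directSum, hF.map_kronecker, hF.map_kronecker, hF.map_kronecker,
      hF.map_unitTensor, map_rotate_matMul₇₂ hF, hS₀, hF.map_matMulTensor_line₁ hdd,
      hF.map_matMulTensor_line₁ h2dd, cs] at h
    simp only [Fin.zero_eta, Fin.isValue, hmul, sq] at h ⊢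
    nlinarith [h]
  · -- direction `θ₁`: the degeneration of `rotate T`, rotated twice
    have hdeg := algDegeneratesTo_rotate_modes (algDegeneratesTo_rotate_modes
      (thm72_degeneration hd (rotate T)))
    simp only [rotate_directSum₇₂, rotate_kronecker₇₂, rotate_rotate_rotate₇₂, rotate_unitTensor₇₂]
      at hdeg
    have h := hF.mono_of_algDegeneratesTo hdeg
    rw [hF.map_directSum, hF.map_directSum, hF.map_kronecker, hF.map_kronecker, hF.map_kronecker,
      hF.map_unitTensor, hS₁, map_rotate_rotate_matMul₇₂ hF, map_rotate_rotate_matMul₇₂ hF,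
      hF.map_matMulTensor_line₂ hdd, hF.map_matMulTensor_line₂ h2dd, cs] at h
    simp only [Fin.mk_one, Fin.isValue, hmul, sq] at h ⊢
    nlinarith [h]
  · -- direction `θ₂`: the degeneration of `rotate² T`, rotated once
    have hdeg := algDegeneratesTo_rotate_modes (thm72_degeneration hd (rotate (rotate T)))
    simp only [rotate_directSum₇₂, rotate_kronecker₇₂, rotate_rotate_rotate₇₂, rotate_unitTensor₇₂]
      at hdeg
    have h := hF.mono_of_algDegeneratesTo hdeg
    rw [hF.map_directSum, hF.map_directSum, hF.map_kronecker, hF.map_kronecker, hF.map_kronecker,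
      hF.map_unitTensor, map_rotate_rotate_matMul₇₂ hF, hS₂, map_rotate_matMul₇₂ hF,
      map_rotate_matMul₇₂ hF, hF.map_matMulTensor_line₃ hdd, hF.map_matMulTensor_line₃ h2dd, cs] at h
    simp only [Fin.reduceFinMk, Fin.isValue, hmul, sq] at h ⊢
    nlinarith [h]

end Spectral

/-! ## Thm. 7.2 -/

section Main

variable (K : Type) [Field K]

/-- **Thm. 7.2 at a spectral point**: `φ(T)² ≤ d^{4ω/3} − (2^{ω/3}−1) ⌊d/3⌋ d^{2ω/3}` — the spectral
inequality in the direction of the least exponent `θ ≤ ϖ/3`, Lemma 9.3 (`h_ϖ` increasing on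
`[0,ϖ/3]`, using `ϖ ≤ 3`, `⌊d/3⌋ ≤ d/3`), Lemma 9.4 (increasing in `ϖ ∈ [2,3]`), `2 ≤ ϖ ≤ ω ≤ 3`
(Prop. 4.2). [cite: AlmanLi2026, Thm. 7.2 (proof)] -/
theorem thm72_pointwise {F : SpectralMap K} (hF : IsUniversalSpectralPoint K F) {d : ℕ} (hd : 3 ≤ d)
    (T : Fin d → Fin d → Fin d → K) :
    F T ≤ Real.sqrt ((d : ℝ) ^ (4 * omega K / 3)
      - ((2 : ℝ) ^ (omega K / 3) - 1) * ((d / 3 : ℕ) : ℝ) * (d : ℝ) ^ (2 * omega K / 3)) := by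
  have hT0 : 0 ≤ F T := hF.nonneg T
  have hd3 : (3 : ℝ) ≤ d := by exact_mod_cast hd
  have hd0 : (0 : ℝ) < d := by linarith
  set θ := specMMPoint K F with hθdef
  set ϖ := ∑ j, θ j with hϖdef
  set p : ℝ := ((d / 3 : ℕ) : ℝ) with hpdef
  have hp0 : 0 ≤ p := Nat.cast_nonneg _
  have hpd : p ≤ (d : ℝ) / 3 := Nat.cast_div_le
  have hϖ2 : 2 ≤ ϖ := AlmanLi2026.prop42_two_le_sum hF
  have hϖω : ϖ ≤ omega K := AlmanLi2026.prop42_sum_le_omega hF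
  have hω3 : omega K ≤ 3 := omega_le_three' K
  have hϖ3 : ϖ ≤ 3 := hϖω.trans hω3
  -- the least exponent `θ i₀ ≤ ϖ/3`
  obtain ⟨i₀, -, hi₀⟩ := Finset.exists_min_image Finset.univ θ Finset.univ_nonempty
  have hmin : θ i₀ ≤ ϖ / 3 := by
    have h3 : 3 * θ i₀ ≤ ∑ j, θ j := by
      rw [Fin.sum_univ_three]
      linarith [hi₀ 0 (Finset.mem_univ _), hi₀ 1 (Finset.mem_univ _), hi₀ 2 (Finset.mem_univ _)]
    linarith
  have hθ0 : 0 ≤ θ i₀ := (AlmanLi2026.prop42_mem_Icc hF i₀).1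
  -- the spectral inequality in that direction, rewritten as `φ(T)² ≤ h_ϖ(θ i₀)`
  have hspec := thm72_spectral hF hd T i₀
  have e2 : ((d * d : ℕ) : ℝ) ^ θ i₀ = (d : ℝ) ^ (2 * θ i₀) := by
    rw [show ((d * d : ℕ) : ℝ) = (d : ℝ) ^ (2 : ℕ) by push_cast; ring, ← Real.rpow_natCast,
      ← Real.rpow_mul hd0.le]; norm_num
  have e3 : ((2 * (d * d) : ℕ) : ℝ) ^ θ i₀ = (2 : ℝ) ^ θ i₀ * (d : ℝ) ^ (2 * θ i₀) := by
    rw [show ((2 * (d * d) : ℕ) : ℝ) = 2 * ((d * d : ℕ) : ℝ) by push_cast; ring,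
      Real.mul_rpow (by norm_num) (Nat.cast_nonneg _), e2]
  rw [e2, e3] at hspec
  have hh : F T ^ 2 ≤ (d : ℝ) ^ (ϖ + θ i₀) - ((2 : ℝ) ^ θ i₀ - 1) * p * (d : ℝ) ^ (2 * θ i₀) := by
    have : F T ^ 2 + p * ((2 : ℝ) ^ θ i₀ * (d : ℝ) ^ (2 * θ i₀)) ≤
        (d : ℝ) ^ (ϖ + θ i₀) + p * (d : ℝ) ^ (2 * θ i₀) := hspec
    nlinarith [this]
  -- Lemma 9.3: `h_ϖ(θ i₀) ≤ h_ϖ(ϖ/3)`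
  have h93 : (d : ℝ) ^ (ϖ + θ i₀) - ((2 : ℝ) ^ θ i₀ - 1) * p * (d : ℝ) ^ (2 * θ i₀) ≤
      (d : ℝ) ^ (ϖ + ϖ / 3) - ((2 : ℝ) ^ (ϖ / 3) - 1) * p * (d : ℝ) ^ (2 * (ϖ / 3)) :=
    (AlmanLi2026.lemma93 hd3 hp0 hpd hϖ2 hϖ3).monotoneOn
      (show θ i₀ ∈ Set.Icc 0 (ϖ / 3) from ⟨hθ0, hmin⟩)
      (show ϖ / 3 ∈ Set.Icc 0 (ϖ / 3) from ⟨by linarith, le_rfl⟩) hmin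
  -- Lemma 9.4: increasing in `ϖ ∈ [2, 3]`, and `ϖ ≤ ω ≤ 3`
  have h94 : (d : ℝ) ^ (4 * ϖ / 3) - ((2 : ℝ) ^ (ϖ / 3) - 1) * p * (d : ℝ) ^ (2 * ϖ / 3) ≤
      (d : ℝ) ^ (4 * omega K / 3) - ((2 : ℝ) ^ (omega K / 3) - 1) * p * (d : ℝ) ^ (2 * omega K / 3) :=
    (AlmanLi2026.lemma94 hd3 hp0 hpd).monotoneOn
      (show ϖ ∈ Set.Icc 2 3 from ⟨hϖ2, hϖ3⟩) (show omega K ∈ Set.Icc 2 3 from ⟨hϖ2.trans hϖω, hω3⟩) hϖω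
  have e4 : (d : ℝ) ^ (ϖ + ϖ / 3) - ((2 : ℝ) ^ (ϖ / 3) - 1) * p * (d : ℝ) ^ (2 * (ϖ / 3)) =
      (d : ℝ) ^ (4 * ϖ / 3) - ((2 : ℝ) ^ (ϖ / 3) - 1) * p * (d : ℝ) ^ (2 * ϖ / 3) := by
    rw [show ϖ + ϖ / 3 = 4 * ϖ / 3 by ring, show 2 * (ϖ / 3) = 2 * ϖ / 3 by ring]
  have hsq : F T ^ 2 ≤ (d : ℝ) ^ (4 * omega K / 3)
      - ((2 : ℝ) ^ (omega K / 3) - 1) * p * (d : ℝ) ^ (2 * omega K / 3) := by linarith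
  exact (Real.le_sqrt hT0 ((sq_nonneg _).trans hsq)).2 hsq

/-- **Alman–Li 2026, Thm. 7.2 (= Thm. 1.4)**: for `d ≥ 3`, every tensor `T : Fin d → Fin d → Fin d → K`
(any field `K`, `ω = omega K`) satisfies
`R̃(T) ≤ sqrt(d^{4ω/3} − ⌊d/3⌋·(2^{ω/3} − 1)·d^{2ω/3})`
(`thm72_pointwise` and Strassen duality). [cite: AlmanLi2026, Thm. 7.2 (= Thm. 1.4)] -/
theorem thm72 {d : ℕ} (hd : 3 ≤ d) (T : Fin d → Fin d → Fin d → K) :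
    asymptoticRank T ≤ Real.sqrt ((d : ℝ) ^ (4 * omega K / 3)
      - ((2 : ℝ) ^ (omega K / 3) - 1) * ((d / 3 : ℕ) : ℝ) * (d : ℝ) ^ (2 * omega K / 3)) :=
  strassen_duality_asymptoticRank.asymptoticRank_le (strassen_duality_asymptoticRank_holds K) T
    fun _ hF => thm72_pointwise K hF hd T

/-- **Thm. 7.2 for any `d × d × d` format** (index types of sizes `≤ d`; "any `d×d×d` tensor"):
zero-padding `T` into `Fin d × Fin d × Fin d` is a restriction, and spectral points are monotone.
[cite: AlmanLi2026, Thm. 7.2 (= Thm. 1.4)] -/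
theorem thm72_of_card_le {ι κ μ : Type} [Fintype ι] [Fintype κ] [Fintype μ] (T : ι → κ → μ → K)
    {d : ℕ} (hd : 3 ≤ d) (hι : Fintype.card ι ≤ d) (hκ : Fintype.card κ ≤ d)
    (hμ : Fintype.card μ ≤ d) :
    asymptoticRank T ≤ Real.sqrt ((d : ℝ) ^ (4 * omega K / 3)
      - ((2 : ℝ) ^ (omega K / 3) - 1) * ((d / 3 : ℕ) : ℝ) * (d : ℝ) ^ (2 * omega K / 3)) := by
  classical
  set eι : ι ↪ Fin d := (Fintype.equivFin ι).toEmbedding.trans (Fin.castLEEmb hι) with heι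
  set eκ : κ ↪ Fin d := (Fintype.equivFin κ).toEmbedding.trans (Fin.castLEEmb hκ) with heκ
  set eμ : μ ↪ Fin d := (Fintype.equivFin μ).toEmbedding.trans (Fin.castLEEmb hμ) with heμ
  -- zero-padding of `T`
  set T' : Fin d → Fin d → Fin d → K := fun x y z =>
    ∑ a, if eι a = x then ∑ b, if eκ b = y then ∑ c, if eμ c = z then T a b c else 0 else 0 else 0
    with hT'
  have hTT' : (fun a b c => T' (eι a) (eκ b) (eμ c)) = T := by
    funext a b c
    simp [hT', eι.injective.eq_iff, eκ.injective.eq_iff, eμ.injective.eq_iff, Finset.sum_ite_eq']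
  have hres : TensorRestrictsTo T' T := by
    have h := tensorRestrictsTo_precomp T' eι eκ eμ
    rwa [hTT'] at h
  exact strassen_duality_asymptoticRank.asymptoticRank_le (strassen_duality_asymptoticRank_holds K) T
    fun F hF => (hF.mono _ _ hres).trans (thm72_pointwise K hF hd T')

end Main

end AlmanLi2026

end Literature.Computability.AlgebraicComplexity
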